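import Mathlib
import Literature.MathematicalPhysics.QuantumFieldTheory.Balaban1983to89.Beta.GaussianIntegral
import Literature.MathematicalPhysics.QuantumFieldTheory.Balaban1983to89.B14LogDet336Matrix

/-!
# `Balaban1983to89.B14Eq333Proof` — T. Bałaban, *Convergent renormalization expansions for lattice gauge theories*, Commun. Math. Phys. **119** (1988) 243–285 [Balaban1988Convergent]: display (3.33) p. 273 — the Gaussian normalization identity of the (k+1)-st fluctuation integral — PROVED at operator level (every finite dimension), and knitted with (3.36)/(3.37)₁ into the Gaussian part of (3.38) p. 274

statement-level skeleton of published theorems with citation tags; proofs where landed; nothing here is a claim about the Yang–Mills mass gap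

PDF held: `paper:balaban1988-cmp119-convergent-renormalization` (journal page = PDF page + 242); the displays below
were read on the page renders `…-p031-x4.png` (p. 273) and `…-p032-x4.png` (p. 274) of
`run/shared/lean/pub/pub-balaban/b2b-balaban-ref1/pages/1988-cmp119-convergent-renormalization/`, READ AS IMAGES
(the OCR layer of p. 273 garbles (3.33); the SKELETON row's informal cell "∫dA exp(−½⟨A,C*ΔCA⟩ + ⟨f,A⟩?)" is the
OCR reading — the printed display has NO linear source term, see the verbatim text below).

WHAT IS REPRODUCED (Phase-2 seat p28 of the mega-formalization `lit-balaban`, SKELETON row `B14.Eq3.33-3.36`, display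
(3.33); the (3.34)₁/(3.35)/(3.36)/(3.37)₁ part of the row is the sibling `…B14LogDet336Matrix`, imported, not modified).
p. 273 [PDF 31], verbatim: *"Consider now the first logarithm on the right-hand side of (3.30). The factor z^{(k)}
comes from elimination of the δ-functions, and is equal to the product of the factors z^{(k)}(c) for c ∈ Λ^{(k+1)}_{k+1}.
We have
  log[ z^{(k)} ∫ dA exp[ −½ ⟨A, C*Δ^{(k)}CA⟩ ] ]
    = Σ_{c∈Λ^{(k+1)}_{k+1}} log z^{(k)}(c) − ½ log det(C*Δ^{(k)}C) + log ∫ dA exp[ −½ |A|² ].          (3.33)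
The last term is a number, which contributes to the vacuum energy renormalization, so we include it into the
definition of E₀^{(k)}. The first term has already the localized form, so we consider the second term."*
p. 274 [PDF 32], verbatim: *"The identities (3.30)–(3.33), (3.36), together with the above definition, imply the
equality [the logarithm on the right-hand side of (3.28)] = Σ_{c∈Λ^{(k+1)}_{k+1}} log z^{(k)}(c)
+ Σ_{b∈Λ^{(k)}_{k+1}} 𝐄₀^{(k+1)}(Λ_{k+1}, b) + const. (3.38)  The constant above is the constant in (3.33), included
into the vacuum renormalization E₀^{(k)}."*

THE MODEL (kind «model-instance», the same finite-dimensional model as `…B14LogDet336Matrix`): the positive operator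
`C*Δ^{(k)}C` on the (finite-dimensional, real) space of fluctuation fields `A` on `Λ^{(k)*}_{k+1}` ↤ a positive definite
real symmetric matrix `T` on a finite index type `n` (the coordinates of `A` in an orthonormal basis for `⟨·,·⟩`), so
`⟨A, C*Δ^{(k)}CA⟩ ↤ A ⬝ᵥ T *ᵥ A`, `|A|² ↤ A ⬝ᵥ A`; `dA` ↤ Lebesgue measure = `volume` on `n → ℝ` (product measure);
the factors `z^{(k)}(c) > 0`, `c ∈ Λ^{(k+1)}_{k+1}` ↤ `z : β → ℝ` on a finite index type `β`, `z^{(k)} = ∏_c z c`.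
§3 also gives the display in the printed letters `T = Cᵀ Δ C` from `Δ` positive definite and `C` injective (the
positivity of `C*Δ^{(k)}C` which p. 273 uses but does not cite — cell GAPS.md G-B14s-11 — enters as these two
DISPLAYED hypotheses, nothing about Bałaban's actual `C`, `Δ^{(k)}` being asserted).

WHAT IS KERNEL-CERTIFIED (0 sorry; Mathlib + two tree modules re-used BY NAME: the cell's Gaussian-integral kernel
`…Beta.GaussianIntegral` — `integral_exp_neg_half_quadForm` `∫ exp(−½ vᵀAv) dv = √(2π)^{|n|}/√(det A)`,
`integral_exp_neg_half_dotProduct_self`, `log_integral_exp_neg_half_quadForm` — and `…B14LogDet336Matrix`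
(`sum_eq337_first`, `sum_fiber_eq337_first`, the corrected-sign (3.36)/(3.37)₁ summed over bonds)):
* §1 the last term of (3.33) IS a (positive) number: `∫ dA exp(−½|A|²) = √(2π)^{|n|} > 0`, `log` of it `= (|n|/2) log 2π`
  (`integral_lastTerm_pos`, `log_lastTerm`);
* §2 (3.33) itself: multiplicatively `∫ dA exp(−½⟨A,TA⟩) = (det T)^{−1/2} ∫ dA exp(−½|A|²)` (`integral_form_eq`,
  positivity `integral_form_pos`) and, verbatim, `log[(∏_c z c) ∫ dA exp(−½⟨A,TA⟩)] = Σ_c log z c − ½ log det T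
  + log ∫ dA exp(−½|A|²)` (`eq333`);
* §3 the same in the printed letters `T = CᵀΔC` (`posDef_transpose_mul_mul`, `eq333_CDeltaC`);
* §4 the Gaussian part of (3.38): (3.33) + the corrected (3.36)/(3.37)₁ of the sibling file give
  `log[(∏_c z c) ∫ dA exp(−½⟨A,TA⟩)] = Σ_c log z c + Σ_i [−½ log λ₀ − ½ ∫₀^∞ dλ (λ₀+λ)⁻¹((T−λ₀I)(T+λI)⁻¹)(i,i)] + const`,
  `const = (|n|/2) log 2π` = the constant in (3.33), per diagonal index (`eq338_gaussianPart`) and grouped along an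
  arbitrary bond-fibre map `bond : n → γ` ("tr(·)(b,b)", `eq338_gaussianPart_fiber`).
Axioms of every theorem ⊆ {propext, Classical.choice, Quot.sound}.

WHAT IS *NOT* REPRODUCED OR ASSERTED: the operators `C`, `Δ^{(k)}` of the series and the spectral bound `λ₀` of
`C*Δ^{(k)}C`; the elimination of the δ-functions producing `z^{(k)}` (B12 (2.12)–(2.13)); the remaining terms of
(3.37)/(3.38) (characteristic functions, the `g_k`-term); anything infinite-dimensional.  Value = kernel certificate of
the printed finite-dimensional Gaussian identity, NOT summit progress.

Unit `lit-balaban-p28` (Phase-2 proof seat p28, agent literature-prover-lit-balaban-p28-0), HOME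
`run/shared/lean/pub/lit-balaban/` (PHASE2-TARGETS.md §G.3 line p28; seat log `lit-balaban-p28/STATUS.md`).

## References
* [Balaban1988Convergent] T. Bałaban, Commun. Math. Phys. 119 (1988) 243–285, doi:10.1007/bf01217741, (3.33) p. 273,
  (3.36)–(3.38) p. 274.
-/

noncomputable section

open MeasureTheory Set Matrix Finset
open scoped Real

namespace Literature.MathematicalPhysics.QuantumFieldTheory.Balaban1983to89.B14Eq333Proof

open Literature.MathematicalPhysics.QuantumFieldTheory.Balaban1983to89

variable {n : Type*} [Fintype n] [DecidableEq n] {T : Matrix n n ℝ}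

/-! ## §1. The last term of (3.33): *"The last term is a number"* -/

omit [DecidableEq n] in
/-- **(3.33), last term** (p. 273 [PDF 31]: *"log ∫ dA exp[−½|A|²] … The last term is a number, which contributes to
the vacuum energy renormalization"*): in the finite-dimensional model the Gaussian normalization
`∫ dA exp(−½|A|²)` over `n → ℝ` (Lebesgue measure) is the positive number `√(2π)^{|n|}`; here: it is positive.
[cite: Balaban1988Convergent, (3.33) p.273] -/
theorem integral_lastTerm_pos : 0 < ∫ A : n → ℝ, Real.exp (-(1/2 : ℝ) * (A ⬝ᵥ A)) := by
  rw [Beta.GaussianIntegral.integral_exp_neg_half_dotProduct_self]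
  exact pow_pos (Real.sqrt_pos.2 (by positivity)) _

omit [DecidableEq n] in
/-- **(3.33), last term, evaluated**: `log ∫ dA exp(−½|A|²) = (|n|/2)·log 2π` — the constant of (3.33) which p. 274
includes into the vacuum-energy renormalization `E₀^{(k)}`. [cite: Balaban1988Convergent, (3.33) p.273] -/
theorem log_lastTerm :
    Real.log (∫ A : n → ℝ, Real.exp (-(1/2 : ℝ) * (A ⬝ᵥ A)))
      = (Fintype.card n : ℝ) / 2 * Real.log (2 * π) := by
  rw [Beta.GaussianIntegral.integral_exp_neg_half_dotProduct_self, Real.log_pow, Real.log_sqrt (by positivity)]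
  ring

/-! ## §2. (3.33): the Gaussian integral of the positive form `⟨A, TA⟩` against its normalization -/

/-- **(3.33), multiplicative form**: for a positive definite real symmetric `T` (the model of `C*Δ^{(k)}C`),
`∫ dA exp(−½⟨A,TA⟩) = (det T)^{−1/2} · ∫ dA exp(−½|A|²)` on `n → ℝ` — the exponential of (3.33) without the
`z^{(k)}`-factor; from the tree's `Beta.GaussianIntegral.integral_exp_neg_half_quadForm`.
[cite: Balaban1988Convergent, (3.33) p.273] -/
theorem integral_form_eq (hT : T.PosDef) :
    ∫ A : n → ℝ, Real.exp (-(1/2 : ℝ) * (A ⬝ᵥ T *ᵥ A))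
      = (Real.sqrt T.det)⁻¹ * ∫ A : n → ℝ, Real.exp (-(1/2 : ℝ) * (A ⬝ᵥ A)) := by
  rw [Beta.GaussianIntegral.integral_exp_neg_half_quadForm T hT,
    Beta.GaussianIntegral.integral_exp_neg_half_dotProduct_self, div_eq_inv_mul]

/-- The fluctuation integral `∫ dA exp(−½⟨A,TA⟩)` is a positive number (so its logarithm in (3.33) is the genuine one).
[cite: Balaban1988Convergent, (3.33) p.273] -/
theorem integral_form_pos (hT : T.PosDef) :
    0 < ∫ A : n → ℝ, Real.exp (-(1/2 : ℝ) * (A ⬝ᵥ T *ᵥ A)) := by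
  rw [integral_form_eq hT]
  exact mul_pos (inv_pos.2 (Real.sqrt_pos.2 hT.det_pos)) integral_lastTerm_pos

/-- **(3.33)** (p. 273 [PDF 31], verbatim): *"The factor z^{(k)} … is equal to the product of the factors z^{(k)}(c)
for c ∈ Λ^{(k+1)}_{k+1}. We have  log[z^{(k)} ∫ dA exp[−½⟨A, C*Δ^{(k)}CA⟩]] = Σ_{c∈Λ^{(k+1)}_{k+1}} log z^{(k)}(c)
− ½ log det(C*Δ^{(k)}C) + log ∫ dA exp[−½|A|²]. (3.33)"* — typed reading (model-instance): `T` positive definite real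
symmetric on the finite index type `n` for `C*Δ^{(k)}C`, `⟨A,A'⟩ = A ⬝ᵥ A'`, `dA` = Lebesgue measure on `n → ℝ`,
`z^{(k)}(c) = z c > 0` on a finite index type `β` (for `Λ^{(k+1)}_{k+1}`), `z^{(k)} = ∏_c z c`.
[cite: Balaban1988Convergent, (3.33) p.273] -/
theorem eq333 {β : Type*} [Fintype β] {z : β → ℝ} (hz : ∀ c, 0 < z c) (hT : T.PosDef) :
    Real.log ((∏ c, z c) * ∫ A : n → ℝ, Real.exp (-(1/2 : ℝ) * (A ⬝ᵥ T *ᵥ A)))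
      = ∑ c, Real.log (z c) - (1/2 : ℝ) * Real.log T.det
        + Real.log (∫ A : n → ℝ, Real.exp (-(1/2 : ℝ) * (A ⬝ᵥ A))) := by
  have hprod : 0 < ∏ c, z c := Finset.prod_pos fun c _ => hz c
  rw [Real.log_mul hprod.ne' (integral_form_pos hT).ne', Real.log_prod (s := univ) (fun c _ => (hz c).ne'),
    Beta.GaussianIntegral.log_integral_exp_neg_half_quadForm T hT, log_lastTerm]
  ring

/-! ## §3. The display in the printed letters `C*Δ^{(k)}C = CᵀΔC` -/

omit [DecidableEq n] in
/-- `CᵀΔC` is positive definite for `Δ` positive definite (on the index type `m` of the fine fields) and `C : m × n`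
injective — the positivity of *"C*Δ^{(k)}C"* that p. 273 uses (*"the contour γ surrounds the spectrum of C*Δ^{(k)}C
… Re z = r, r positive"*), from the two displayed hypotheses (Mathlib's `Matrix.PosDef.conjTranspose_mul_mul_same`).
[cite: Balaban1988Convergent, (3.33) p.273] -/
theorem posDef_transpose_mul_mul {m : Type*} [Fintype m] {Δ : Matrix m m ℝ} (hΔ : Δ.PosDef) {C : Matrix m n ℝ}
    (hC : Function.Injective C.mulVec) : (Cᵀ * Δ * C).PosDef := by
  have h := hΔ.conjTranspose_mul_mul_same hC
  rwa [Matrix.conjTranspose_eq_transpose_of_trivial] at h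

/-- **(3.33) in the printed letters**: with `T = CᵀΔC`, `Δ` positive definite, `C` injective, `z c > 0`:
`log[(∏_c z c) ∫ dA exp(−½⟨A, CᵀΔC A⟩)] = Σ_c log z c − ½ log det(CᵀΔC) + log ∫ dA exp(−½|A|²)`.
[cite: Balaban1988Convergent, (3.33) p.273] -/
theorem eq333_CDeltaC {m : Type*} [Fintype m] {Δ : Matrix m m ℝ} (hΔ : Δ.PosDef) {C : Matrix m n ℝ}
    (hC : Function.Injective C.mulVec) {β : Type*} [Fintype β] {z : β → ℝ} (hz : ∀ c, 0 < z c) :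
    Real.log ((∏ c, z c) * ∫ A : n → ℝ, Real.exp (-(1/2 : ℝ) * (A ⬝ᵥ (Cᵀ * Δ * C) *ᵥ A)))
      = ∑ c, Real.log (z c) - (1/2 : ℝ) * Real.log (Cᵀ * Δ * C).det
        + Real.log (∫ A : n → ℝ, Real.exp (-(1/2 : ℝ) * (A ⬝ᵥ A))) :=
  eq333 hz (posDef_transpose_mul_mul hΔ hC)

/-! ## §4. Knitting (3.33) with (3.36)/(3.37)₁: the Gaussian part of (3.38) -/

/-- **(3.38), Gaussian part** (p. 274 [PDF 32]: *"The identities (3.30)–(3.33), (3.36), together with the above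
definition, imply the equality [the logarithm on the right-hand side of (3.28)] = Σ_{c∈Λ^{(k+1)}_{k+1}} log z^{(k)}(c)
+ Σ_{b∈Λ^{(k)}_{k+1}} 𝐄₀^{(k+1)}(Λ_{k+1}, b) + const. (3.38) The constant above is the constant in (3.33)"*), restricted
to the Gaussian term `log[z^{(k)} ∫ dA exp(−½⟨A,C*Δ^{(k)}CA⟩)]` of (3.30) and the FIRST bracket of 𝐄₀^{(k+1)} in (3.37),
WITH THE CORRECTED SIGN "−½∫" of the sibling file (cell DIVERGENCE.md D-pv02.5), per diagonal index ("bond") `i`: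
`log[(∏_c z c) ∫ dA exp(−½⟨A,TA⟩)] = Σ_c log z c + Σ_i [−½ log λ₀ − ½ ∫₀^∞ dλ (λ₀+λ)⁻¹ ((T−λ₀I)(T+λI)⁻¹)(i,i)] + const`,
`const = (|n|/2)·log 2π` = the constant in (3.33); any `λ₀ > 0`. [cite: Balaban1988Convergent, (3.38) p.274] -/
theorem eq338_gaussianPart {β : Type*} [Fintype β] {z : β → ℝ} (hz : ∀ c, 0 < z c) (hT : T.PosDef)
    {lam0 : ℝ} (h0 : 0 < lam0) :
    Real.log ((∏ c, z c) * ∫ A : n → ℝ, Real.exp (-(1/2 : ℝ) * (A ⬝ᵥ T *ᵥ A)))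
      = ∑ c, Real.log (z c)
        + ∑ i, (-(1 / 2 : ℝ) * Real.log lam0
            - (1 / 2 : ℝ) * ∫ x in Ioi (0 : ℝ),
                (lam0 + x)⁻¹ * ((T - lam0 • (1 : Matrix n n ℝ)) * (T + x • 1)⁻¹) i i)
        + (Fintype.card n : ℝ) / 2 * Real.log (2 * π) := by
  rw [eq333 hz hT, B14LogDet336Matrix.sum_eq337_first hT h0, log_lastTerm]
  ring

/-- **(3.38), Gaussian part, grouped along an arbitrary bond-fibre map** `bond : n → γ` (B14's "tr(·)(b, b)" read as
the sum of the diagonal entries in the fibre of the bond `b`, per-bond constant `−½ log λ₀ · |fibre b|`, as in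
`B14LogDet336Matrix.sum_fiber_eq337_first`):
`log[(∏_c z c) ∫ dA exp(−½⟨A,TA⟩)] = Σ_c log z c + Σ_b [−½ log λ₀·|fibre b| − ½ ∫₀^∞ dλ (λ₀+λ)⁻¹ Σ_{i∈fibre b}
((T−λ₀I)(T+λI)⁻¹)(i,i)] + (|n|/2)·log 2π` (corrected sign; any `λ₀ > 0`). [cite: Balaban1988Convergent, (3.38) p.274] -/
theorem eq338_gaussianPart_fiber {β γ : Type*} [Fintype β] [Fintype γ] [DecidableEq γ] (bond : n → γ)
    {z : β → ℝ} (hz : ∀ c, 0 < z c) (hT : T.PosDef) {lam0 : ℝ} (h0 : 0 < lam0) :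
    Real.log ((∏ c, z c) * ∫ A : n → ℝ, Real.exp (-(1/2 : ℝ) * (A ⬝ᵥ T *ᵥ A)))
      = ∑ c, Real.log (z c)
        + ∑ b, (-(1 / 2 : ℝ) * Real.log lam0 * #{i | bond i = b}
            - (1 / 2 : ℝ) * ∫ x in Ioi (0 : ℝ), (lam0 + x)⁻¹
                * ∑ i ∈ univ.filter (fun i => bond i = b), ((T - lam0 • (1 : Matrix n n ℝ)) * (T + x • 1)⁻¹) i i)
        + (Fintype.card n : ℝ) / 2 * Real.log (2 * π) := by
  rw [eq333 hz hT, B14LogDet336Matrix.sum_fiber_eq337_first bond hT h0, log_lastTerm]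
  ring

end Literature.MathematicalPhysics.QuantumFieldTheory.Balaban1983to89.B14Eq333Proof
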